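import Mathlib
import Summits.ValiantsHypothesis.ValiantsHypothesis.Theorems.BinomialElusiveBinomialCandidatePolarStepTwo

/-!
# Crux `BinomialElusive.BinomialCandidate` (stmt-ValiantsHypothesis-7392), line `registered`,
# skeleton v7 — stub `stub_polarStepTwoMinors`: the second peeling step at a pole over `x = 0`,
# recording the `2 × 2` minors of the integral remainder

The registered stub `stub_polarStepTwoMinors` of the crux
`Summit.ValiantsHypothesis.ValiantsHypothesis.Theses.BinomialElusive.BinomialCandidate`.
Data: a quadratic `Γ : ℂ^s → ℂ^m` (`totalDegree (Γ i) ≤ 2`), `N ≥ 1`, a formal Laurent solution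
`p` of `Γ_i(p) = t^{N a_i} + t^{N b_i}` (targets WITHOUT coefficients at negative exponents) with
least order `μ < 0`, pole direction `z = (p_j.coeff μ)_j ≠ 0`, and `B_i(z) = 0` for all `i`
(`B_i = homogeneousComponent 2 (Γ i)`).  Claim (dichotomy): EITHER there is a second direction
`z' ∉ ℂ z` with `Σ_j z'_j ∂_jB_i(z) = 0` for ALL `i`, OR the minors `z_k p_j - z_j p_k` have no
coefficients at negative exponents and there is a point `w` with
`(z_k p_j - z_j p_k).coeff 0 = z_k w_j - z_j w_k` for all `j, k` (this pins `w` modulo `ℂ z`)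
and `Σ_j z_j (∂_jΓ_i)(w) = 0` for all `i`.

Proof: the proof of the sibling stub `stub_polarStepTwo` (imported tree file, whose chart
`PolarStepTwo.exists_chart` we reuse: `p j = Λ q j`, `Λ` without coefficients below `μ` and
coefficient `1` at `μ`, `q j` the jet `z j + v j t^o` up to order `o`, `0 < o ≤ -μ`, `v j₀ = 0`
where `z j₀ ≠ 0`, and `v ≠ 0` if `o < -μ`), with a richer second branch.

* `o < -μ` (the remainder has a pole): verbatim, first disjunct with `z' = v`
  (`InfinityStepTwo.coeff_aeval_of_jet`).
* `o = -μ` (the remainder is integral, with value `v`): second disjunct with `w = v`.  The last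
  clause is verbatim (`InfinityStepTwoImproper.coeff_aeval_of_jet_top`,
  `InfinityStepTwoImproper.sum_mul_eval_pderiv_eq`).  For the minors,
  `z_k p_j - z_j p_k = Λ d` with `d = z_k q_j - z_j q_k`; by the jet formula `d` has no
  coefficients below `o` and coefficient `z_k v_j - z_j v_k` at `o` (the constant terms cancel),
  so `Λ d` has no coefficients below `μ + o = 0` and coefficient
  `Λ.coeff μ · d.coeff o = z_k v_j - z_j v_k` there (`PolarPeeling.coeff_mul_eq_zero_of_lt`,
  `PolarPeeling.coeff_mul_eq`).

Mathlib only, plus the tree files imported above.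
-/

-- layout Summits/ValiantsHypothesis/ValiantsHypothesis forces the duplicated namespace component
set_option linter.dupNamespace false

namespace Summit.ValiantsHypothesis.ValiantsHypothesis.Theorems.BinomialCandidateStubs

open scoped BigOperators

namespace PolarStepTwoMinors

/-- **Minors of two jets.**  If `x = zx + vx t^o + …` and `y = zy + vy t^o + …` up to order
`o > 0`, the minor `zy • x - zx • y` has no coefficients below `o` and coefficient
`zy vx - zx vy` at `o`. -/
theorem coeff_minor_of_jet {o : ℤ} (ho : 0 < o) {x y : LaurentSeries ℂ} {zx zy vx vy : ℂ}
    (hx : ∀ g ≤ o, x.coeff g = (if g = 0 then zx else 0) + if g = o then vx else 0)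
    (hy : ∀ g ≤ o, y.coeff g = (if g = 0 then zy else 0) + if g = o then vy else 0) :
    (∀ g < o, (zy • x - zx • y).coeff g = 0) ∧
      (zy • x - zx • y).coeff o = zy * vx - zx * vy := by
  refine ⟨fun g hg => ?_, ?_⟩
  · rw [HahnSeries.coeff_sub, HahnSeries.coeff_smul, HahnSeries.coeff_smul, smul_eq_mul,
      smul_eq_mul, hx g hg.le, hy g hg.le, if_neg hg.ne, if_neg hg.ne]
    split_ifs <;> ring
  · rw [HahnSeries.coeff_sub, HahnSeries.coeff_smul, HahnSeries.coeff_smul, smul_eq_mul,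
      smul_eq_mul, hx o le_rfl, hy o le_rfl, if_neg ho.ne', if_neg ho.ne', if_pos rfl, if_pos rfl]
    ring

/-- **Minors in the chart of a pole.**  With `Λ` without coefficients below `μ` and coefficient
`1` at `μ`, and jets `x = zx + vx t^o + …`, `y = zy + vy t^o + …` (`o > 0`), the minor
`zy • (Λ x) - zx • (Λ y) = Λ (zy • x - zx • y)` has no coefficients below `μ + o` and
coefficient `zy vx - zx vy` at `μ + o`. -/
theorem coeff_minor_mul_of_jet {μ o : ℤ} (ho : 0 < o) {Λ : LaurentSeries ℂ}
    (hΛ : ∀ g < μ, Λ.coeff g = 0) (hΛμ : Λ.coeff μ = 1) {x y : LaurentSeries ℂ}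
    {zx zy vx vy : ℂ}
    (hx : ∀ g ≤ o, x.coeff g = (if g = 0 then zx else 0) + if g = o then vx else 0)
    (hy : ∀ g ≤ o, y.coeff g = (if g = 0 then zy else 0) + if g = o then vy else 0) :
    (∀ g < μ + o, (zy • (Λ * x) - zx • (Λ * y)).coeff g = 0) ∧
      (zy • (Λ * x) - zx • (Λ * y)).coeff (μ + o) = zy * vx - zx * vy := by
  obtain ⟨hvan, htop⟩ := coeff_minor_of_jet ho hx hy
  have hfac : zy • (Λ * x) - zx • (Λ * y) = Λ * (zy • x - zx • y) := by
    simp only [← HahnSeries.C_mul_eq_smul]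
    ring
  rw [hfac]
  exact ⟨PolarPeeling.coeff_mul_eq_zero_of_lt hΛ hvan,
    by rw [PolarPeeling.coeff_mul_eq hΛ hvan, hΛμ, one_mul, htop]⟩

end PolarStepTwoMinors

open PolarStepTwo PolarStepTwoMinors in
/-- **Stub `stub_polarStepTwoMinors`** (crux stmt-ValiantsHypothesis-7392, line `registered`,
skeleton v7): the second peeling step at a pole over `x = 0`, with the minors of the remainder.
Given a formal Laurent solution `p` of `Γ_i(p) = t^{N a_i} + t^{N b_i}` (`Γ` quadratic, `N ≥ 1`)
with least order `μ < 0`, pole direction `z = (p_j.coeff μ)_j ≠ 0` and `B_i(z) = 0` for all `i`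
(`B_i = homogeneousComponent 2 (Γ i)`): either there is a second direction `z' ∉ ℂ z` with
`Σ_j z'_j ∂_jB_i(z) = 0` for all `i`, or all the minors `z_k p_j - z_j p_k` have no coefficients
at negative exponents and there is a point `w` with
`(z_k p_j - z_j p_k).coeff 0 = z_k w_j - z_j w_k` for all `j, k` and `Σ_j z_j (∂_jΓ_i)(w) = 0`
for all `i` (`dΓ(w) · z = 0`). -/
theorem stub_polarStepTwoMinors :
    ∀ (m s : ℕ) (a b : Fin m → ℕ) (Γ : Fin m → MvPolynomial (Fin s) ℂ) (N : ℕ) (p : Fin s → LaurentSeries ℂ)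
      (μ : ℤ), (∀ i, (Γ i).totalDegree ≤ 2) → 0 < N →
      (∀ i, MvPolynomial.aeval p (Γ i) =
        HahnSeries.single ((N * a i : ℕ) : ℤ) (1 : ℂ) + HahnSeries.single ((N * b i : ℕ) : ℤ) (1 : ℂ)) →
      μ < 0 → (∀ j, ∀ g < μ, (p j).coeff g = 0) → (fun j => (p j).coeff μ) ≠ 0 →
      (∀ i, MvPolynomial.eval (fun j => (p j).coeff μ) (MvPolynomial.homogeneousComponent 2 (Γ i)) = 0) →
      (∃ z' : Fin s → ℂ, (∀ c : ℂ, z' ≠ c • (fun j => (p j).coeff μ)) ∧ ∀ i,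
          ∑ j, z' j * MvPolynomial.eval (fun l => (p l).coeff μ)
            (MvPolynomial.pderiv j (MvPolynomial.homogeneousComponent 2 (Γ i))) = 0) ∨
      ((∀ j k, ∀ g < 0, ((p k).coeff μ • p j - (p j).coeff μ • p k).coeff g = 0) ∧
        ∃ w : Fin s → ℂ,
          (∀ j k, ((p k).coeff μ • p j - (p j).coeff μ • p k).coeff 0 = (p k).coeff μ * w j - (p j).coeff μ * w k) ∧
          ∀ i, ∑ j, (p j).coeff μ * MvPolynomial.eval w (MvPolynomial.pderiv j (Γ i)) = 0) := by
  -- adapted from the sibling stub `stub_polarStepTwo` (imported tree file)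
  intro m s a b Γ N p μ hΓ _hN hsol hμ hp hz hBz
  classical
  -- the pole direction `z` and a coordinate `j₀` with `z j₀ ≠ 0`
  set z : Fin s → ℂ := fun j => (p j).coeff μ
  obtain ⟨j₀, hj₀⟩ : ∃ j₀, z j₀ ≠ 0 := Function.ne_iff.mp hz
  -- the chart of the pole: `p j = Λ q j`, `q j` the jet `z j + v j t^o`, `0 < o ≤ -μ`, `v j₀ = 0`
  obtain ⟨Λ, q, o, v, hΛvan, hΛμ, hpq, ho, hoμ, hjq, hvj₀, hv0⟩ :=
    exists_chart p hμ hp z (fun _ => rfl) hj₀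
  -- the outputs, in the chart, have no coefficients at negative exponents
  have hout : ∀ i, ∀ g < 0, (MvPolynomial.aeval (fun j => Λ * q j) (Γ i)).coeff g = 0 := by
    intro i g hg
    have h := hsol i
    rw [hpq] at h
    rw [h]
    exact PolarPeeling.coeff_binomial_eq_zero_of_neg N (a i) (b i) g hg
  -- `Γ_i(p)` has no coefficients below `2μ + o`, and coefficient `Σ_j v_j ∂_jB_i(z)` there
  have key := fun i => InfinityStepTwo.coeff_aeval_of_jet ho hoμ Λ hΛvan hΛμ q z v hjq (Γ i)
    (hΓ i) (hBz i)
  rcases hoμ.lt_or_eq with hlt | heq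
  · -- `o < -μ` (the remainder has a pole): the direction `v ∉ ℂ z`, first disjunct
    left
    refine ⟨v, fun c hc => ?_, fun i => ((key i).2 hlt).symm.trans (hout i _ (by omega))⟩
    have hc₀ := congr_fun hc j₀
    simp only [Pi.smul_apply, smul_eq_mul] at hc₀
    rw [hvj₀] at hc₀
    rcases mul_eq_zero.mp hc₀.symm with h | h
    · refine hv0 hlt ?_
      rw [hc, h, zero_smul]
    · exact hj₀ h
  · -- `o = -μ` (the remainder is integral, with value `v`): second disjunct with `w = v`
    right
    -- the minors `z k • p j - z j • p k = Λ (z k • q j - z j • q k)`: no coefficients below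
    -- `μ + o = 0`, coefficient `z k * v j - z j * v k` at `μ + o = 0`
    have hpj : ∀ j, p j = Λ * q j := fun j => congr_fun hpq j
    have hmin : ∀ j k, (∀ g < μ + o, (z k • p j - z j • p k).coeff g = 0) ∧
        (z k • p j - z j • p k).coeff (μ + o) = z k * v j - z j * v k := by
      intro j k
      have h := coeff_minor_mul_of_jet ho hΛvan hΛμ (hjq j) (hjq k)
      rwa [← hpj j, ← hpj k] at h
    have h0 : μ + o = 0 := by omega
    refine ⟨fun j k g hg => (hmin j k).1 g (by omega), v, fun j k => ?_, fun i => ?_⟩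
    · have h := (hmin j k).2
      rw [h0] at h
      exact h
    · exact (InfinityStepTwoImproper.sum_mul_eval_pderiv_eq (Γ i) (hΓ i) z v).trans
        ((InfinityStepTwoImproper.coeff_aeval_of_jet_top ho heq Λ hΛvan hΛμ q z v hjq (Γ i)
          (hΓ i) (hBz i)).symm.trans (hout i μ hμ))

end Summit.ValiantsHypothesis.ValiantsHypothesis.Theorems.BinomialCandidateStubs
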